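import Literature.NumberTheory.Weil1964.ArchWeilDatumOfCoefficients
import Literature.RepresentationTheory.KonnoKonno2007.JunctionContinuityKAK
import Literature.RepresentationTheory.KonnoKonno2007.RealUnitaryRankOneKAK
import HarnessLib

/-!
# The real unitary groups `U(p,q)`, `min(p,q) ≤ 1`, and their dual pairs carry no non-trivial continuous positive character (Knapp 2002, Thm 7.39)

Topic `RepresentationTheory/KonnoKonno2007`; namespace `Literature.RepresentationTheory.KonnoKonno2007.RealDualPair`.
KERNEL MATHEMATICS ONLY: proved theorems; no definition, no `def … : Prop` record, no axiom, no proof hole.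

`Weil1964.ArchWeilDatumOfCoefficients.isArchWeilDatum_of_coeff` / `hasUnitaryLift_of_coeff` derive the unitary-lift
clause (w2′) of an archimedean Weil datum from ONE group-theoretic input on the group `G`: every continuous positive
multiplicative function `n : G → ℝ` (`n (g h) = n g · n h`, `n > 0`) is identically `1`.  This file discharges that
input for Konno–Konno's standard real unitary groups `UForm α β = U(|α|,|β|)` of real rank `≤ 1` (the rank profiles for
which the tree holds the `K·A·K` decomposition `RealUnitaryRankOneKAK`), for their dual pairs
`Ginf P Q R S = U(P,Q) × U(R,S)`, and for finite products (the archimedean pair group of a hermitian dual pair over a CM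
field, place by place):

* `mulPos_eq_one_of_surjective` — transfer along a continuous surjective homomorphism;
* `UForm.mulPos_eq_one_of_kV_surjective` — `U(α) × U(β) → U(α,β)` onto (a definite form: `…_of_isEmpty_right/left`):
  the group is the continuous image of a compact group (`Weil1964.mulPos_eq_one_of_compactSpace`);
* `UForm.mulPos_eq_one_of_rankOne` — `|β| = 1`: `U(α,β) = K · {a_t} · K` (`kakMap_surjective`), `K = U(α) × U(β)`
  compact, and the Weyl element `w` inverts the boosts (`kV_weylKV_mul_hypV_mul_inv`), so `n(a_t) = 1`
  (`Weil1964.mulPos_eq_one_of_conj_eq_inv`) and `n ≡ 1` (`Weil1964.mulPos_eq_one_of_kak`);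
* `mulPos_eq_one_pair` — dual pairs `U(P,Q) × U(R,S)` from the two factors (`Weil1964.mulPos_prod_eq_one`), with the
  four profile corollaries `…_of_rankOne_rankOne`, `…_of_rankOne_compact`, `…_of_compact_rankOne`, `…_of_compact_compact`;
* `mulPos_eq_one_pi` — finite products over places (`Weil1964.mulPos_pi_eq_one`).

Everything is PROVED from the imported tree files; no cited statement is a hypothesis.

## References

* [Knapp2002] A. W. Knapp, *Lie Groups Beyond an Introduction*, 2nd ed., Progress in Mathematics 140, Birkhäuser,
  2002: Theorem 7.39 (`G = K A K`), p. 457.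
* [KonnoKonno2007] K. Konno, T. Konno, *On doubling construction for real unitary dual pairs*, Kyushu J. Math. 61
  (2007) 35–82, §3.1 (the pairs `U(p,q) × U(r,s)`).
* [Folland1989] G. B. Folland, *Harmonic Analysis in Phase Space*, Princeton UP (1989), §4.2, the Schur remark p. 156
  (where the input is consumed).

## Provenance

LEAN-IN-TREE rule (2026-08-18), pub-hodgecm model-construction sub-cell, discharge seat mc-discharge-3 (ticket D-3, (J-arch)
(w2′) = BINDER-OWNERS §1a rows 10/16/17 sub-item (c4)).  Nothing here is a claim of the manuscripts adjudicated by that cell.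
-/

noncomputable section

open Matrix Complex Topology Filter

namespace Literature.RepresentationTheory.KonnoKonno2007

namespace RealDualPair

open Literature.NumberTheory.Weil1964 Literature.NumberTheory.Automorphic Literature.NumberTheory.Automorphic.UnitaryGroup
open Literature.Analysis.SegalBargmann

/-! ## 1. Transfer along continuous surjective homomorphisms -/

section Transfer

/-- **Transfer**: if `φ : H →* G` is a continuous surjective homomorphism and `H` carries no non-trivial continuous
positive multiplicative function, neither does `G`. [folklore] -/
theorem mulPos_eq_one_of_surjective {H G : Type*} [Group H] [Group G] [TopologicalSpace H] [TopologicalSpace G]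
    (φ : H →* G) (hφ : Continuous φ) (hsurj : Function.Surjective φ)
    (hH : ∀ n : H → ℝ, (∀ g h, n (g * h) = n g * n h) → (∀ g, 0 < n g) → Continuous n → ∀ g, n g = 1)
    (n : G → ℝ) (hn : ∀ g h, n (g * h) = n g * n h) (hpos : ∀ g, 0 < n g) (hcont : Continuous n) (g : G) :
    n g = 1 := by
  obtain ⟨x, rfl⟩ := hsurj g
  exact hH (fun x => n (φ x)) (fun x y => by rw [map_mul, hn]) (fun _ => hpos _) (hcont.comp hφ) x

end Transfer

/-! ## 2. One factor `U(α, β)` -/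

section Single

variable {α β : Type*} [Fintype α] [DecidableEq α] [Fintype β] [DecidableEq β]

/-- `K = U(α) × U(β)` is a compact space. [folklore] -/
theorem compactSpace_KV : CompactSpace (KV α β) := by
  haveI := compactSpace_matrixUnitaryGroup α
  haveI := compactSpace_matrixUnitaryGroup β
  infer_instance

/-- **`U(α) × U(β) → U(α,β)` onto** (definite forms): every continuous positive multiplicative function on `U(α,β)` is
trivial. [folklore] -/
theorem UForm.mulPos_eq_one_of_kV_surjective (h : Function.Surjective (UForm.kV α β)) (n : UForm α β → ℝ)
    (hn : ∀ g h, n (g * h) = n g * n h) (hpos : ∀ g, 0 < n g) (hcont : Continuous n) (g : UForm α β) : n g = 1 :=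
  haveI : CompactSpace (KV α β) := compactSpace_KV
  mulPos_eq_one_of_surjective (UForm.kV α β) UForm.continuous_kV h
    (fun m hm hmpos hmc => mulPos_eq_one_of_compactSpace m hm hmpos hmc) n hn hpos hcont g

/-- … positive definite form (`β` empty). [folklore] -/
theorem UForm.mulPos_eq_one_of_isEmpty_right [IsEmpty β] (n : UForm α β → ℝ) (hn : ∀ g h, n (g * h) = n g * n h)
    (hpos : ∀ g, 0 < n g) (hcont : Continuous n) (g : UForm α β) : n g = 1 :=
  UForm.mulPos_eq_one_of_kV_surjective UForm.kV_surjective_of_isEmpty_right n hn hpos hcont g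

/-- … negative definite form (`α` empty). [folklore] -/
theorem UForm.mulPos_eq_one_of_isEmpty_left [IsEmpty α] (n : UForm α β → ℝ) (hn : ∀ g h, n (g * h) = n g * n h)
    (hpos : ∀ g, 0 < n g) (hcont : Continuous n) (g : UForm α β) : n g = 1 :=
  UForm.mulPos_eq_one_of_kV_surjective UForm.kV_surjective_of_isEmpty_left n hn hpos hcont g

/-- The Weyl element `w` conjugates the boost `a_t` to its inverse. [folklore] -/
theorem kV_weylKV_conj_hypV_eq_inv (p₀ : α) (q₀ : β) (t : ℝ) :
    UForm.kV α β (weylKV p₀) * hypV p₀ q₀ t * (UForm.kV α β (weylKV p₀))⁻¹ = (hypV p₀ q₀ t)⁻¹ := by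
  rw [kV_weylKV_mul_hypV_mul_inv, hypV_neg]

/-- **Real rank one** (`|β| = 1`): every continuous positive multiplicative function on `U(α,β)` is trivial —
`U(α,β) = K · {a_t} · K` with `K` compact and `w a_t w⁻¹ = a_t⁻¹`. [cite: Knapp2002, Thm 7.39] -/
theorem UForm.mulPos_eq_one_of_rankOne (p₀ : α) (q₀ : β) [Subsingleton β] (n : UForm α β → ℝ)
    (hn : ∀ g h, n (g * h) = n g * n h) (hpos : ∀ g, 0 < n g) (hcont : Continuous n) (g : UForm α β) : n g = 1 :=
  haveI : CompactSpace (KV α β) := compactSpace_KV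
  mulPos_eq_one_of_kak (UForm.kV α β) UForm.continuous_kV (fun t : ℝ => (hypV p₀ q₀ t : UForm α β))
    (kakMap_surjective p₀ q₀) n hn hpos hcont
    (fun t => mulPos_eq_one_of_conj_eq_inv hn hpos (kV_weylKV_conj_hypV_eq_inv p₀ q₀ t)) g

end Single

/-! ## 3. Dual pairs `U(P,Q) × U(R,S)` and products over places -/

section PairPi

variable {P Q R S : Type*} [Fintype P] [DecidableEq P] [Fintype Q] [DecidableEq Q] [Fintype R] [DecidableEq R]
  [Fintype S] [DecidableEq S]

/-- **Dual pairs**: if neither `U(P,Q)` nor `U(R,S)` carries a non-trivial continuous positive multiplicative function,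
neither does `U(P,Q) × U(R,S)`. [folklore] -/
theorem mulPos_eq_one_pair
    (hV : ∀ n : UForm P Q → ℝ, (∀ g h, n (g * h) = n g * n h) → (∀ g, 0 < n g) → Continuous n → ∀ g, n g = 1)
    (hW : ∀ n : UForm R S → ℝ, (∀ g h, n (g * h) = n g * n h) → (∀ g, 0 < n g) → Continuous n → ∀ g, n g = 1)
    (n : Ginf P Q R S → ℝ) (hn : ∀ g h, n (g * h) = n g * n h) (hpos : ∀ g, 0 < n g) (hcont : Continuous n)
    (g : Ginf P Q R S) : n g = 1 :=
  mulPos_prod_eq_one hV hW n hn hpos hcont g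

/-- … both factors of real rank one (`|Q| = |S| = 1`, e.g. `U(2,1) × U(1,1)`). [cite: Knapp2002, Thm 7.39] -/
theorem mulPos_eq_one_of_rankOne_rankOne (p₀ : P) (q₀ : Q) (r₀ : R) (s₀ : S) [Subsingleton Q] [Subsingleton S]
    (n : Ginf P Q R S → ℝ) (hn : ∀ g h, n (g * h) = n g * n h) (hpos : ∀ g, 0 < n g) (hcont : Continuous n)
    (g : Ginf P Q R S) : n g = 1 :=
  mulPos_eq_one_pair (UForm.mulPos_eq_one_of_rankOne p₀ q₀) (UForm.mulPos_eq_one_of_rankOne r₀ s₀) n hn hpos hcont g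

/-- … first factor of real rank one, second with `U(R) × U(S) → U(R,S)` onto (e.g. `U(2,1) × U(2)`).
[cite: Knapp2002, Thm 7.39] -/
theorem mulPos_eq_one_of_rankOne_compact (p₀ : P) (q₀ : Q) [Subsingleton Q] (hW : Function.Surjective (UForm.kV R S))
    (n : Ginf P Q R S → ℝ) (hn : ∀ g h, n (g * h) = n g * n h) (hpos : ∀ g, 0 < n g) (hcont : Continuous n)
    (g : Ginf P Q R S) : n g = 1 :=
  mulPos_eq_one_pair (UForm.mulPos_eq_one_of_rankOne p₀ q₀) (UForm.mulPos_eq_one_of_kV_surjective hW) n hn hpos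
    hcont g

/-- … first factor with `U(P) × U(Q) → U(P,Q)` onto, second of real rank one (e.g. `U(3) × U(1,1)`).
[cite: Knapp2002, Thm 7.39] -/
theorem mulPos_eq_one_of_compact_rankOne (hV : Function.Surjective (UForm.kV P Q)) (r₀ : R) (s₀ : S) [Subsingleton S]
    (n : Ginf P Q R S → ℝ) (hn : ∀ g h, n (g * h) = n g * n h) (hpos : ∀ g, 0 < n g) (hcont : Continuous n)
    (g : Ginf P Q R S) : n g = 1 :=
  mulPos_eq_one_pair (UForm.mulPos_eq_one_of_kV_surjective hV) (UForm.mulPos_eq_one_of_rankOne r₀ s₀) n hn hpos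
    hcont g

/-- … both factors with surjective `kV` (both forms definite). [folklore] -/
theorem mulPos_eq_one_of_compact_compact (hV : Function.Surjective (UForm.kV P Q))
    (hW : Function.Surjective (UForm.kV R S)) (n : Ginf P Q R S → ℝ) (hn : ∀ g h, n (g * h) = n g * n h)
    (hpos : ∀ g, 0 < n g) (hcont : Continuous n) (g : Ginf P Q R S) : n g = 1 :=
  mulPos_eq_one_pair (UForm.mulPos_eq_one_of_kV_surjective hV) (UForm.mulPos_eq_one_of_kV_surjective hW) n hn hpos
    hcont g

/-- **Finite products over places**: if at every place `v` the pair `U(P_v,Q_v) × U(R_v,S_v)` carries no non-trivial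
continuous positive multiplicative function, neither does `Π v, U(P_v,Q_v) × U(R_v,S_v)`. [folklore] -/
theorem mulPos_eq_one_pi {o : Type*} [Fintype o] [DecidableEq o] {P' Q' R' S' : o → Type*}
    [∀ v, Fintype (P' v)] [∀ v, DecidableEq (P' v)] [∀ v, Fintype (Q' v)] [∀ v, DecidableEq (Q' v)]
    [∀ v, Fintype (R' v)] [∀ v, DecidableEq (R' v)] [∀ v, Fintype (S' v)] [∀ v, DecidableEq (S' v)]
    (h : ∀ v, ∀ n : Ginf (P' v) (Q' v) (R' v) (S' v) → ℝ,
      (∀ g g', n (g * g') = n g * n g') → (∀ g, 0 < n g) → Continuous n → ∀ g, n g = 1)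
    (n : (∀ v, Ginf (P' v) (Q' v) (R' v) (S' v)) → ℝ) (hn : ∀ g g', n (g * g') = n g * n g')
    (hpos : ∀ g, 0 < n g) (hcont : Continuous n) (g : ∀ v, Ginf (P' v) (Q' v) (R' v) (S' v)) : n g = 1 :=
  mulPos_pi_eq_one (H := fun v => Ginf (P' v) (Q' v) (R' v) (S' v)) h n hn hpos hcont g

end PairPi

end RealDualPair

end Literature.RepresentationTheory.KonnoKonno2007
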